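import Mathlib
import Summits.ValiantsHypothesis.ValiantsHypothesis.Theorems.GrenetZeonPolySizeQPAlgebraResidualCorankTwo
import Summits.ValiantsHypothesis.ValiantsHypothesis.Theorems.GrenetZeonPolySizeQPAlgebraLocalReductionResidual
import HarnessLib

/-!
# Crux `GrenetZeon.PolySizeQPAlgebra` (stmt-ValiantsHypothesis-8064), line `vbp-slice-dealg` —
# the reduction of `…LocalReduction` with the local Hessian bound required ONLY at residual corank `≥ 3`

`…LocalReduction` empties every point `(n, s)` of the `c = 1` box from a good `(s+1)`-space (threshold
`2sn`) and the inlined type-independent hypothesis `LocalHessianBound n` (`det A(p) = 0` in the local piece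
`R` ⟹ `rank Hess λ(det A)(p) ≤ 2·dim R·n`); `…LocalReductionResidual` shrank the hypothesis to residual
corank `≥ 2` using `…ResidualCorankOne`.  With `…ResidualCorankTwo` (the bound at every point with a unit
`(n-2)`-minor of `A(p)`, for every coefficient algebra) the remaining input is, BY NAME:

  `LocalHessianBound₃ n`: the bound `rank Hess F(p) ≤ 2·dim R·n` only at points `p` with `det A(p) = 0`
  in `R` AND all `(n-2) × (n-2)` minors of `A(p)` in the maximal ideal (`φ` kills them: residual corank
  `≥ 3`, i.e. `A(p) ≃ diag(1_k, S)` with `S ∈ Mat_q(𝔪)`, `q ≥ 3`).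

* `localHessianBound_of_residualCorankThree` — `LocalHessianBound₃ n → LocalHessianBound n` (case split
  at `p`: some residual `(n-2)`-minor non-zero ⟹ `rank_hess0_transl_le_of_residual_minor_ne_zero`;
  `n ≤ 1` directly).
* `not_hasAlgDetRepr_perPoly_self_of_localHessianBound₃` — `LocalHessianBound₃ n` and a good `c`-space
  with `s < c`, threshold `≥ 2sn` give `¬ HasAlgDetRepr per_n n s`.
* `corner_all_large_of_localHessianBound₃` — the all-large-`n` column form for every fixed `s`.

In particular the open part of input (B) is now exactly the residual corank `q ≥ 3` (the inequality
`AL(q)` / conjecture G of the hand memos); `q ≤ 2` is a theorem for every coefficient algebra.  HONEST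
FRAMING: bookkeeping of a conditional reduction; no stub of the line is closed; VP ≠ VNP is not moved.

References: T. Mignon, N. Ressayre, IMRN 2004:79, §2 [MignonRessayre2004].
-/

noncomputable section

open MvPolynomial Matrix
open Literature.Computability.AlgebraicComplexity

-- single-conjunct layout `Summits/ValiantsHypothesis/ValiantsHypothesis`: duplicated namespace by design
set_option linter.dupNamespace false

namespace Summit.ValiantsHypothesis.ValiantsHypothesis.Theorems.GrenetZeonPolySizeQPAlgebra

/-- **`LocalHessianBound₃ n → LocalHessianBound n`.**  If the local Hessian bound
`rank Hess F(p) ≤ 2·dim R·n` holds at all points of residual corank `≥ 3` (all `(n-2)`-minors of `A(p)`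
killed by the character `φ`), then it holds at every point with `det A(p) = 0` in `R`: at the other points
some `(n-2)`-minor of `A(p)` is a unit and `rank_hess0_transl_le_of_residual_minor_ne_zero` applies
(`n ≥ 2`; for `n ≤ 1` the value matrix vanishes and `rank_hess0_transl_le_of_mulVec_eq_zero` applies).
[cite: MignonRessayre2004, §2] -/
theorem localHessianBound_of_residualCorankThree {n : ℕ}
    (hH₃ : ∀ (R : Type) [CommRing R] [Algebra ℂ R] [Module.Finite ℂ R] (φ : R →ₐ[ℂ] ℂ) (ν : ℕ),
      RingHom.ker (φ : R →+* ℂ) ^ ν = ⊥ →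
      ∀ (l : R →ₗ[ℂ] ℂ), (∀ r : R, (∀ x, l (x * r) = 0) → r = 0) →
      ∀ (A : Matrix (Fin n) (Fin n) (MvPolynomial (Fin n × Fin n) R)) (F : MvPolynomial (Fin n × Fin n) ℂ),
        (∀ a b, (A a b).IsHomogeneous 1) → (∀ d, l (coeff d A.det) = coeff d F) →
        ∀ p : Fin n × Fin n → ℂ, eval (fun i => algebraMap ℂ R (p i)) A.det = 0 →
          (∀ r c : Fin (n - 2) → Fin n,
            φ ((A.map (eval (fun i => algebraMap ℂ R (p i)))).submatrix r c).det = 0) →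
          (hess0 (transl p F)).rank ≤ 2 * Module.finrank ℂ R * n) :
    ∀ (R : Type) [CommRing R] [Algebra ℂ R] [Module.Finite ℂ R] (φ : R →ₐ[ℂ] ℂ) (ν : ℕ),
      RingHom.ker (φ : R →+* ℂ) ^ ν = ⊥ →
      ∀ (l : R →ₗ[ℂ] ℂ), (∀ r : R, (∀ x, l (x * r) = 0) → r = 0) →
      ∀ (A : Matrix (Fin n) (Fin n) (MvPolynomial (Fin n × Fin n) R)) (F : MvPolynomial (Fin n × Fin n) ℂ),
        (∀ a b, (A a b).IsHomogeneous 1) → (∀ d, l (coeff d A.det) = coeff d F) →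
        ∀ p : Fin n × Fin n → ℂ, eval (fun i => algebraMap ℂ R (p i)) A.det = 0 →
          (hess0 (transl p F)).rank ≤ 2 * Module.finrank ℂ R * n := by
  intro R _ _ _ φ ν hker l hl A F hA hF p hp
  have hA' : ∀ a b, (A a b).totalDegree ≤ 1 := fun a b => (hA a b).totalDegree_le
  by_cases h : ∃ r c : Fin (n - 2) → Fin n,
      φ ((A.map (eval (fun i => algebraMap ℂ R (p i)))).submatrix r c).det ≠ 0
  · obtain ⟨r, c, hrc⟩ := h
    rcases Nat.lt_or_ge n 2 with hn | hn
    · haveI : Nontrivial R := RingHom.domain_nontrivial (φ : R →+* ℂ)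
      interval_cases n
      · -- `n = 0`: `det A = 1` cannot vanish at `p`
        exfalso
        rw [Matrix.det_isEmpty, map_one] at hp
        exact one_ne_zero hp
      · -- `n = 1`: the value matrix is `0`, `w = 1` is a unimodular kernel vector
        have hB : (A.map (eval fun i => algebraMap ℂ R (p i))).det = 0 := by
          rw [← RingHom.mapMatrix_apply, ← RingHom.map_det, hp]
        have hmv : Matrix.mulVec (A.map (eval fun i => algebraMap ℂ R (p i))) (fun _ => (1 : R)) = 0 := by
          ext i
          fin_cases i
          rw [Matrix.det_fin_one, Matrix.map_apply] at hB
          simp [Matrix.mulVec, dotProduct, hB]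
        simpa using rank_hess0_transl_le_of_mulVec_eq_zero l A F hA' hF p (fun _ => (1 : R)) hmv
          ⟨0, isUnit_one⟩
    · obtain ⟨k, rfl⟩ : ∃ k, n = k + 2 := ⟨n - 2, by omega⟩
      simpa using rank_hess0_transl_le_of_residual_minor_ne_zero φ hker l A F hA' hF p hp r c hrc
        (by simp)
  · push Not at h
    exact hH₃ R φ ν hker l hl A F hA hF p hp h

/-- **Every point `(n, s)` from `LocalHessianBound₃ n` and a good `(s+1)`-space** (`…LocalReduction` with
the smaller input): a good `c`-space with `s < c` and threshold `t ≥ 2sn` at `n ≥ 1` excludes every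
`(n, s)`-representation of `per_n`, provided the local Hessian bound holds at residual corank `≥ 3`.
[cite: MignonRessayre2004, §2] -/
theorem not_hasAlgDetRepr_perPoly_self_of_localHessianBound₃ {n s c t : ℕ} (hn : 1 ≤ n)
    (hH₃ : ∀ (R : Type) [CommRing R] [Algebra ℂ R] [Module.Finite ℂ R] (φ : R →ₐ[ℂ] ℂ) (ν : ℕ),
      RingHom.ker (φ : R →+* ℂ) ^ ν = ⊥ →
      ∀ (l : R →ₗ[ℂ] ℂ), (∀ r : R, (∀ x, l (x * r) = 0) → r = 0) →
      ∀ (A : Matrix (Fin n) (Fin n) (MvPolynomial (Fin n × Fin n) R)) (F : MvPolynomial (Fin n × Fin n) ℂ),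
        (∀ a b, (A a b).IsHomogeneous 1) → (∀ d, l (coeff d A.det) = coeff d F) →
        ∀ p : Fin n × Fin n → ℂ, eval (fun i => algebraMap ℂ R (p i)) A.det = 0 →
          (∀ r c : Fin (n - 2) → Fin n,
            φ ((A.map (eval (fun i => algebraMap ℂ R (p i)))).submatrix r c).det = 0) →
          (hess0 (transl p F)).rank ≤ 2 * Module.finrank ℂ R * n)
    (hW : ∃ w : Fin c → (Fin n × Fin n → ℂ), LinearIndependent ℂ w ∧
      ∀ a : Fin c → ℂ, a ≠ 0 → eval (∑ i, a i • w i) (perPoly (Fin n) ℂ) = 0 →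
        t < (hess0 (transl (∑ i, a i • w i) (perPoly (Fin n) ℂ))).rank)
    (hsc : s < c) (ht : 2 * s * n ≤ t) : ¬ HasAlgDetRepr (perPoly (Fin n) ℂ) n s :=
  not_hasAlgDetRepr_perPoly_self_of_localHessianBound hn
    (localHessianBound_of_residualCorankThree hH₃) hW hsc ht

/-- **All large `n`, every fixed `s`, from `LocalHessianBound₃`:** the residual-corank-`≥ 3` local
Hessian bound at every `n` and good `(s+1)`-spaces with threshold `2sn` for all large `n` empty the whole
column `(m, s') ≤ (n, s)` of the `c = 1` box for all large `n`. [folklore] -/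
theorem corner_all_large_of_localHessianBound₃ (s : ℕ)
    (hH₃ : ∀ n : ℕ, ∀ (R : Type) [CommRing R] [Algebra ℂ R] [Module.Finite ℂ R] (φ : R →ₐ[ℂ] ℂ) (ν : ℕ),
      RingHom.ker (φ : R →+* ℂ) ^ ν = ⊥ →
      ∀ (l : R →ₗ[ℂ] ℂ), (∀ r : R, (∀ x, l (x * r) = 0) → r = 0) →
      ∀ (A : Matrix (Fin n) (Fin n) (MvPolynomial (Fin n × Fin n) R)) (F : MvPolynomial (Fin n × Fin n) ℂ),
        (∀ a b, (A a b).IsHomogeneous 1) → (∀ d, l (coeff d A.det) = coeff d F) →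
        ∀ p : Fin n × Fin n → ℂ, eval (fun i => algebraMap ℂ R (p i)) A.det = 0 →
          (∀ r c : Fin (n - 2) → Fin n,
            φ ((A.map (eval (fun i => algebraMap ℂ R (p i)))).submatrix r c).det = 0) →
          (hess0 (transl p F)).rank ≤ 2 * Module.finrank ℂ R * n)
    (hW : ∃ n₀ : ℕ, ∀ n ≥ n₀, ∃ w : Fin (s + 1) → (Fin n × Fin n → ℂ), LinearIndependent ℂ w ∧
      ∀ a : Fin (s + 1) → ℂ, a ≠ 0 → eval (∑ i, a i • w i) (perPoly (Fin n) ℂ) = 0 →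
        2 * s * n < (hess0 (transl (∑ i, a i • w i) (perPoly (Fin n) ℂ))).rank) :
    ∃ n₀ : ℕ, ∀ n ≥ n₀, ∀ m s' : ℕ, m ≤ n → s' ≤ s → ¬ HasAlgDetRepr (perPoly (Fin n) ℂ) m s' :=
  corner_all_large_of_localHessianBound s
    (fun n => localHessianBound_of_residualCorankThree (hH₃ n)) hW

end Summit.ValiantsHypothesis.ValiantsHypothesis.Theorems.GrenetZeonPolySizeQPAlgebra

end
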